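import Literature.MathematicalPhysics.QuantumLattice.HubbardChargeGapSpinGap
import Literature.MathematicalPhysics.QuantumLattice.HubbardHalfFilledGroundStateTorus
import HarnessLib

/-!
# Tian's inequality `Δ_s ≤ Δ_c` on the even square torus

Topic `MathematicalPhysics/QuantumLattice` (family `hubbard`); companion of
`HubbardChargeGapSpinGap` (G.-S. Tian, Phys. Rev. B **58** (1998) 7612, Theorem: at half filling on
a bipartite lattice with `|A| = |B|` and `U ≥ 0` the charged gap dominates the spin excitation gap)
for the certified-numerics cells working on the square torus `(ℤ/Lℤ)²`, `L` even: the
graph-theoretic hypotheses (bipartition by the staggering sign `ε_x = (-1)^{x₁+x₂}` with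
`2|A| = L²`, `A ≠ ∅`) are the tree's `LiebHalfFilled.hubbardTorus_lieb_hypotheses`
(`HubbardHalfFilledGroundStateTorus`), so the three inequalities of `HubbardChargeGapSpinGap` hold
on `fermionTorusGraph 2 L` with no hypothesis besides `L` even, `L ≠ 0`, `U ≥ 0` (any real `t`):

* `hubbardTorus_szOne_add_ground_add_U_le`: `E(L², S^z=1) + E₀(L²) + U ≤ 2 E₀(L² + 1)`;
* `hubbardTorus_szOne_add_ground_sub_U_le`: `E(L², S^z=1) + E₀(L²) - U ≤ 2 E₀(L² - 1)`;
* `hubbardTorus_minEnergyOn_szSector_one_sub_groundEnergyAt_le_chargeGap`: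
  `E(L², S^z=1) - E₀(L²) ≤ Δ_c(L²) = E₀(L²+1) + E₀(L²-1) - 2E₀(L²)`;
* `chargeGap_pos_halfFilling` (general connected bipartite graph, `|A| = |B| ≥ 1`, `t ≠ 0`, `U > 0`)
  and `hubbardTorus_chargeGap_pos`: `0 < Δ_c(|Λ|)` — Tian's inequality combined with Lieb's
  positive spin gap (`LiebHalfFilled.groundEnergyAt_lt_minEnergyOn_szSector_one`); Tian's
  Remark 4 (finite systems have a Mott charged gap), in the weak form `Δ_c ≥ Δ_s > 0`.

* `hubbardTorus_chargeGap_eq`: `Δ_c(L²) = 2(E₀(L²-1) - E₀(L²)) + U` (particle–hole symmetry), and the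
  certificate-facing forms `hubbardTorus_minEnergyOn_szSector_one_le_of_bounds`
  (`E(L², S^z=1) ≤ 2·up(E₀(L²-1)) - lo(E₀(L²)) + U`) and `hubbardTorus_chargeGap_ge_of_bounds`
  (`σ(E(L², S^z=1)) - up(E₀(L²)) ≤ Δ_c(L²)`).

* nonnegativity without Lieb's hypotheses (`U ≥ 0`, any `t`, no connectivity):
  `chargeGap_nonneg_halfFilling` / `hubbardTorus_chargeGap_nonneg` (`0 ≤ Δ_c`), and the
  chemical-potential statements `hubbardTorus_half_U_le_groundEnergyAt_succ_sub`
  (`U/2 ≤ E₀(L²+1) - E₀(L²)`), `hubbardTorus_groundEnergyAt_sub_pred_le` (`E₀(L²) - E₀(L²-1) ≤ U/2`).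

Theorems only; no definitions, no named facts.

## References

* G.-S. Tian, Phys. Rev. B 58 (1998) 7612, Theorem and eqs. (Bound3)–(Bound4). [Tian1998ChargeSpinGap]
* E. H. Lieb, Phys. Rev. Lett. 62 (1989) 1201, Theorem 2 (the torus hypotheses). [LiebPRL1989]
-/

noncomputable section

namespace Literature.MathematicalPhysics.QuantumLattice

open Matrix Finset

section Torus

variable {L : ℕ} [NeZero L]

omit [NeZero L] in
/-- `|(ℤ/Lℤ)²| = L²`. [folklore] -/
private theorem card_fermionTorus_two' : Fintype.card (FermionTorus 2 L) = L ^ 2 := by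
  simp only [FermionTorus, Fintype.card_lex, Fintype.card_fun, Fintype.card_fin]

/-- **Tian's (Bound3) at `N = L² + 1` on the even square torus** (convention `U n↑ n↓`):
`E(L², S^z = 1) + E₀(L²) + U ≤ 2 E₀(L² + 1)` for `L` even, `L ≠ 0`, `U ≥ 0`, any real `t`.
Tian, PRB 58 (1998) 7612, eq. (Bound3). [cite: Tian1998ChargeSpinGap, eq. (Bound3)] -/
theorem hubbardTorus_szOne_add_ground_add_U_le (hL : Even L) (t : ℝ) {U : ℝ} (hU : 0 ≤ U) :
    (hamiltonian (fermionTorusGraph 2 L) t U).minEnergyOn (szSector (L ^ 2) 1) +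
        groundEnergyAt (fermionTorusGraph 2 L) t U (L ^ 2) + U ≤
      2 * groundEnergyAt (fermionTorusGraph 2 L) t U (L ^ 2 + 1) := by
  obtain ⟨-, hA, h2, hA0⟩ := LiebHalfFilled.hubbardTorus_lieb_hypotheses (L := L) hL
  rw [card_fermionTorus_two'] at h2
  have h := hubbard_halfFilled_szOne_add_ground_add_U_le (fermionTorusGraph 2 L) _ hA
    (Nat.one_le_iff_ne_zero.2 hA0.card_pos.ne') (by rw [card_fermionTorus_two']; omega) t hU
  rwa [h2] at h

/-- **Tian's (Bound3) at `N = L² - 1` on the even square torus** (convention `U n↑ n↓`):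
`E(L², S^z = 1) + E₀(L²) - U ≤ 2 E₀(L² - 1)` for `L` even, `L ≠ 0`, `U ≥ 0`, any real `t`.
Tian, PRB 58 (1998) 7612, eq. (Bound3). [cite: Tian1998ChargeSpinGap, eq. (Bound3)] -/
theorem hubbardTorus_szOne_add_ground_sub_U_le (hL : Even L) (t : ℝ) {U : ℝ} (hU : 0 ≤ U) :
    (hamiltonian (fermionTorusGraph 2 L) t U).minEnergyOn (szSector (L ^ 2) 1) +
        groundEnergyAt (fermionTorusGraph 2 L) t U (L ^ 2) - U ≤
      2 * groundEnergyAt (fermionTorusGraph 2 L) t U (L ^ 2 - 1) := by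
  obtain ⟨-, hA, h2, hA0⟩ := LiebHalfFilled.hubbardTorus_lieb_hypotheses (L := L) hL
  rw [card_fermionTorus_two'] at h2
  have h := hubbard_halfFilled_szOne_add_ground_sub_U_le (fermionTorusGraph 2 L) _ hA
    (Nat.one_le_iff_ne_zero.2 hA0.card_pos.ne') (by rw [card_fermionTorus_two']; omega) t hU
  rwa [h2] at h

/-- **Tian's theorem on the even square torus: the charge gap dominates the spin gap at half
filling.** For the Hubbard model `-tΣc†c + UΣn↑n↓` on `(ℤ/Lℤ)²` with `L` even, `L ≠ 0`, `U ≥ 0`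
(any real `t`), at `N = L²`:
`E(L², S^z = 1) - E₀(L²) ≤ Δ_c(L²) = E₀(L² + 1) + E₀(L² - 1) - 2 E₀(L²)`.
Tian, PRB 58 (1998) 7612, Theorem. [cite: Tian1998ChargeSpinGap, Theorem] -/
theorem hubbardTorus_minEnergyOn_szSector_one_sub_groundEnergyAt_le_chargeGap (hL : Even L)
    (t : ℝ) {U : ℝ} (hU : 0 ≤ U) :
    (hamiltonian (fermionTorusGraph 2 L) t U).minEnergyOn (szSector (L ^ 2) 1) -
        groundEnergyAt (fermionTorusGraph 2 L) t U (L ^ 2) ≤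
      chargeGap (fermionTorusGraph 2 L) t U (L ^ 2) := by
  obtain ⟨-, hA, h2, hA0⟩ := LiebHalfFilled.hubbardTorus_lieb_hypotheses (L := L) hL
  have hcard := LiebHalfFilled.compl_card_eq_card_of_two_mul h2
  rw [← card_fermionTorus_two']
  exact minEnergyOn_szSector_one_sub_groundEnergyAt_le_chargeGap _ _ hA hcard hA0 t hU

/-! ### Positive charge gap in finite volume -/

omit [NeZero L] in
/-- **A finite half-filled Hubbard cluster has a positive charge gap** (`Δ_c(|Λ|) > 0`): under
Lieb's hypotheses (`G` connected and bipartite with `|A| = |B| ≥ 1`, `t ≠ 0`, `U > 0`) the spin gap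
`E(|Λ|, S^z = 1) - E₀(|Λ|)` is positive (the ground state is the unique singlet,
`LiebHalfFilled.groundEnergyAt_lt_minEnergyOn_szSector_one`, Lieb's Theorem 2) and is dominated by
the charge gap (`minEnergyOn_szSector_one_sub_groundEnergyAt_le_chargeGap`, Tian's theorem), so
`0 < E₀(|Λ|+1) + E₀(|Λ|-1) - 2E₀(|Λ|)`. Tian, PRB 58 (1998) 7612, Remark 4 ("for any finite
lattice ... the systems have a Mott charged gap"; the strict form `Δ_c > Δ_s` of that remark is not
asserted here). [cite: Tian1998ChargeSpinGap, Remark 4] [cite: LiebPRL1989, Theorem 2] -/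
theorem chargeGap_pos_halfFilling {Λ : Type*} [LinearOrder Λ] [Fintype Λ] (G : SimpleGraph Λ)
    [DecidableRel G.Adj] (hG : G.Connected) (A : Finset Λ)
    (hA : ∀ x y : Λ, G.Adj x y → (x ∈ A ↔ y ∉ A)) (hcard : Aᶜ.card = A.card) (hA0 : A.Nonempty)
    {t U : ℝ} (ht : t ≠ 0) (hU : 0 < U) :
    0 < chargeGap G t U (Fintype.card Λ) :=
  lt_of_lt_of_le
    (sub_pos.2 (LiebHalfFilled.groundEnergyAt_lt_minEnergyOn_szSector_one hG A hA hcard hA0 ht hU))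
    (minEnergyOn_szSector_one_sub_groundEnergyAt_le_chargeGap G A hA hcard hA0 t hU.le)

/-- **Positive charge gap of the half-filled even square torus**: for `L` even, `L ≠ 0`, `t ≠ 0`,
`U > 0`, `0 < Δ_c(L²) = E₀(L²+1) + E₀(L²-1) - 2E₀(L²)` on `(ℤ/Lℤ)²` (Lieb's hypotheses are
`LiebHalfFilled.hubbardTorus_lieb_hypotheses`). Tian, PRB 58 (1998) 7612, Remark 4; Lieb, PRL 62
(1989) 1201, Theorem 2. [cite: Tian1998ChargeSpinGap, Remark 4] [cite: LiebPRL1989, Theorem 2] -/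
theorem hubbardTorus_chargeGap_pos (hL : Even L) {t U : ℝ} (ht : t ≠ 0) (hU : 0 < U) :
    0 < chargeGap (fermionTorusGraph 2 L) t U (L ^ 2) := by
  obtain ⟨hG, hA, h2, hA0⟩ := LiebHalfFilled.hubbardTorus_lieb_hypotheses (L := L) hL
  have hcard := LiebHalfFilled.compl_card_eq_card_of_two_mul h2
  rw [← card_fermionTorus_two']
  exact chargeGap_pos_halfFilling _ hG _ hA hcard hA0 ht hU

/-! ### Particle–hole symmetric forms on the torus -/

/-- **The charge gap of the half-filled even torus from the hole side alone**: by the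
particle–hole symmetry of the bipartite torus (`groundEnergyAt_fermionTorus_particleHole`:
`E₀(L² + 1) = E₀(L² - 1) + U` in the convention `U n↑ n↓`),
`Δ_c(L²) = 2 (E₀(L² - 1) - E₀(L²)) + U` for `L` even, `L ≠ 0` (any `t`, `U`).
Lieb–Wu, PRL 20 (1968) 1445, eq. (17) and the particle–hole map; Tian, PRB 58 (1998) 7612, Step 4.
[cite: Tian1998ChargeSpinGap, Step 4] -/
theorem hubbardTorus_chargeGap_eq (hL : Even L) (t U : ℝ) :
    chargeGap (fermionTorusGraph 2 L) t U (L ^ 2) =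
      2 * (groundEnergyAt (fermionTorusGraph 2 L) t U (L ^ 2 - 1) -
        groundEnergyAt (fermionTorusGraph 2 L) t U (L ^ 2)) + U := by
  have hL0 : 0 < L := Nat.pos_of_ne_zero (NeZero.ne L)
  have hL2 : 1 ≤ L ^ 2 := Nat.one_le_pow _ _ hL0
  have h := groundEnergyAt_fermionTorus_particleHole (d := 2) hL t U (N := L ^ 2 + 1) (by omega)
  rw [show 2 * L ^ 2 - (L ^ 2 + 1) = L ^ 2 - 1 by omega] at h
  rw [chargeGap, h]
  push_cast
  ring

/-- **Certified-numerics form of Tian's theorem on the torus**: the half-filled triplet energy is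
controlled by the one-hole ground-state energy, `E(L², S^z = 1) ≤ 2 E₀(L² - 1) - E₀(L²) + U`
(`hubbardTorus_szOne_add_ground_sub_U_le` rearranged), so an upper bound on `E₀(L² - 1)` and a
lower bound on `E₀(L²)` bound the triplet energy from above. Tian, PRB 58 (1998) 7612, eq. (Bound3).
[cite: Tian1998ChargeSpinGap, eq. (Bound3)] -/
theorem hubbardTorus_minEnergyOn_szSector_one_le_of_bounds (hL : Even L) (t : ℝ) {U : ℝ}
    (hU : 0 ≤ U) {up lo : ℝ} (hup : groundEnergyAt (fermionTorusGraph 2 L) t U (L ^ 2 - 1) ≤ up)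
    (hlo : lo ≤ groundEnergyAt (fermionTorusGraph 2 L) t U (L ^ 2)) :
    (hamiltonian (fermionTorusGraph 2 L) t U).minEnergyOn (szSector (L ^ 2) 1) ≤ 2 * up - lo + U := by
  have h := hubbardTorus_szOne_add_ground_sub_U_le (L := L) hL t hU
  linarith

/-- **A certified lower bound on the half-filled charge gap of the torus from a triplet-sector
floor**: if `σ ≤ E(L², S^z = 1)` (e.g. a one-block certificate on `(N↑, N↓) = (L²/2 + 1, L²/2 - 1)`)
and `E₀(L²) ≤ up`, then `σ - up ≤ Δ_c(L²)`. Tian, PRB 58 (1998) 7612, Theorem.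
[cite: Tian1998ChargeSpinGap, Theorem] -/
theorem hubbardTorus_chargeGap_ge_of_bounds (hL : Even L) (t : ℝ) {U : ℝ} (hU : 0 ≤ U)
    {σ up : ℝ} (hσ : σ ≤ (hamiltonian (fermionTorusGraph 2 L) t U).minEnergyOn (szSector (L ^ 2) 1))
    (hup : groundEnergyAt (fermionTorusGraph 2 L) t U (L ^ 2) ≤ up) :
    σ - up ≤ chargeGap (fermionTorusGraph 2 L) t U (L ^ 2) := by
  have h := hubbardTorus_minEnergyOn_szSector_one_sub_groundEnergyAt_le_chargeGap (L := L) hL t hU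
  linarith

/-! ### Nonnegativity: the spin gap, hence the charge gap, is nonnegative at half filling -/

/-- **The spin gap is nonnegative**: `E₀(|Λ|) ≤ E(|Λ|, S^z = 1)` whenever `|Λ| = 2(m + 1) ≥ 2`
(the sector is non-trivial, `LiebHalfFilled.szSector_one_ne_bot`, and the ground-state energy is
the minimum of the Rayleigh quotient over all `|Λ|`-particle vectors). Any graph, any `t`, `U`.
Tasaki (2020) §2.2 (variational principle). [folklore] -/
private theorem groundEnergyAt_le_minEnergyOn_szSector_one {Λ : Type*} [LinearOrder Λ] [Fintype Λ]
    (G : SimpleGraph Λ) [DecidableRel G.Adj] (t U : ℝ) {m : ℕ}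
    (hΛ : Fintype.card Λ = 2 * (m + 1)) :
    groundEnergyAt G t U (Fintype.card Λ) ≤
      (hamiltonian G t U).minEnergyOn (szSector (Fintype.card Λ) 1) := by
  classical
  set H := hamiltonian G t U with hH
  set N := Fintype.card Λ with hN
  have hHerm : H.IsHermitian := LiebThm1.hamiltonian_isHermitian G t U
  have hK₁ne : (szSector N 1 : Submodule ℂ (Fock (Orb Λ))) ≠ ⊥ := by
    rw [hΛ]
    exact LiebHalfFilled.szSector_one_ne_bot (by omega)
  obtain ⟨u, huK, hu1, hHu⟩ := exists_unit_eigen_minEnergyOn hHerm (szSector N 1)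
    (fun v hv => LiebHalfFilled.hamiltonian_mulVec_mem_szSector G t U hv) hK₁ne
  obtain ⟨huN, -⟩ := (mem_szSector_iff _ _ _).1 huK
  have hE : groundEnergyAt G t U N = H.minEnergyOn (nParticleSubmodule (ι := Orb Λ) N) :=
    groundEnergy_eq_minEnergyOn H N _ (fun _ => Iff.rfl)
  have h := minEnergyOn_mul_le_re_rayleigh hHerm (nParticleSubmodule (ι := Orb Λ) N)
    ((mem_nParticleSubmodule_iff N u).2 huN)
  rw [hu1, Complex.one_re, mul_one, hHu, dotProduct_smul, hu1, smul_eq_mul, mul_one,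
    Complex.ofReal_re, ← hE] at h
  exact h

/-- **The charge gap of a half-filled balanced bipartite Hubbard cluster is nonnegative** for
every `U ≥ 0` and every real `t` (no connectivity needed): `0 ≤ E(|Λ|, S^z=1) - E₀(|Λ|) ≤ Δ_c(|Λ|)`
(Tian's inequality and the variational principle), i.e. `E₀(|Λ|+1) + E₀(|Λ|-1) ≥ 2 E₀(|Λ|)` — the
ground-state energy is midpoint-convex in the particle number at half filling. Tian, PRB 58 (1998)
7612, Theorem. [cite: Tian1998ChargeSpinGap, Theorem] -/
theorem chargeGap_nonneg_halfFilling {Λ : Type*} [LinearOrder Λ] [Fintype Λ] (G : SimpleGraph Λ)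
    [DecidableRel G.Adj] (A : Finset Λ) (hA : ∀ x y : Λ, G.Adj x y → (x ∈ A ↔ y ∉ A))
    (hcard : Aᶜ.card = A.card) (hA0 : A.Nonempty) (t : ℝ) {U : ℝ} (hU : 0 ≤ U) :
    0 ≤ chargeGap G t U (Fintype.card Λ) := by
  have hΛ : Fintype.card Λ = 2 * A.card := by
    rw [← Finset.card_add_card_compl A, hcard, two_mul]
  obtain ⟨k, hk⟩ : ∃ k, A.card = k + 1 := Nat.exists_eq_add_one.2 hA0.card_pos
  rw [hk] at hΛ
  have h1 := groundEnergyAt_le_minEnergyOn_szSector_one G t U hΛ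
  have h2 := minEnergyOn_szSector_one_sub_groundEnergyAt_le_chargeGap G A hA hcard hA0 t hU
  linarith

/-- **Nonnegative charge gap of the half-filled even torus**: `0 ≤ Δ_c(L²)` for `L` even, `L ≠ 0`,
`U ≥ 0`, any real `t`. Tian, PRB 58 (1998) 7612, Theorem. [cite: Tian1998ChargeSpinGap, Theorem] -/
theorem hubbardTorus_chargeGap_nonneg (hL : Even L) (t : ℝ) {U : ℝ} (hU : 0 ≤ U) :
    0 ≤ chargeGap (fermionTorusGraph 2 L) t U (L ^ 2) := by
  obtain ⟨-, hA, h2, hA0⟩ := LiebHalfFilled.hubbardTorus_lieb_hypotheses (L := L) hL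
  have hcard := LiebHalfFilled.compl_card_eq_card_of_two_mul h2
  rw [← card_fermionTorus_two']
  exact chargeGap_nonneg_halfFilling _ _ hA hcard hA0 t hU

/-- **Half filling sits at chemical potential `U/2` (particle side)**: on the even torus with
`U ≥ 0`, `U/2 ≤ E₀(L² + 1) - E₀(L²)` — from `E(L², S^z=1) + E₀(L²) + U ≤ 2E₀(L²+1)` and
`E₀(L²) ≤ E(L², S^z=1)`; by particle–hole symmetry equivalently `E₀(L²) - E₀(L²-1) ≤ U/2`
(`hubbardTorus_groundEnergyAt_sub_pred_le`). Convention `U n↑ n↓`. Tian, PRB 58 (1998) 7612,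
eq. (Bound3). [cite: Tian1998ChargeSpinGap, eq. (Bound3)] -/
theorem hubbardTorus_half_U_le_groundEnergyAt_succ_sub (hL : Even L) (t : ℝ) {U : ℝ}
    (hU : 0 ≤ U) :
    U / 2 ≤ groundEnergyAt (fermionTorusGraph 2 L) t U (L ^ 2 + 1) -
      groundEnergyAt (fermionTorusGraph 2 L) t U (L ^ 2) := by
  obtain ⟨-, -, h2, hA0⟩ := LiebHalfFilled.hubbardTorus_lieb_hypotheses (L := L) hL
  obtain ⟨k, hk⟩ : ∃ k, (Finset.univ.filter fun x : FermionTorus 2 L => torusStagger x = 1).card =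
      k + 1 := Nat.exists_eq_add_one.2 hA0.card_pos
  have hΛ : Fintype.card (FermionTorus 2 L) = 2 * (k + 1) := by rw [← hk]; omega
  have h0 := groundEnergyAt_le_minEnergyOn_szSector_one (fermionTorusGraph 2 L) t U hΛ
  rw [card_fermionTorus_two'] at h0
  have h1 := hubbardTorus_szOne_add_ground_add_U_le (L := L) hL t hU
  linarith

/-- **Half filling sits at chemical potential `U/2` (hole side)**: on the even torus with `U ≥ 0`,
`E₀(L²) - E₀(L² - 1) ≤ U/2`. Convention `U n↑ n↓`. Tian, PRB 58 (1998) 7612, eq. (Bound3).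
[cite: Tian1998ChargeSpinGap, eq. (Bound3)] -/
theorem hubbardTorus_groundEnergyAt_sub_pred_le (hL : Even L) (t : ℝ) {U : ℝ} (hU : 0 ≤ U) :
    groundEnergyAt (fermionTorusGraph 2 L) t U (L ^ 2) -
        groundEnergyAt (fermionTorusGraph 2 L) t U (L ^ 2 - 1) ≤ U / 2 := by
  obtain ⟨-, -, h2, hA0⟩ := LiebHalfFilled.hubbardTorus_lieb_hypotheses (L := L) hL
  obtain ⟨k, hk⟩ : ∃ k, (Finset.univ.filter fun x : FermionTorus 2 L => torusStagger x = 1).card =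
      k + 1 := Nat.exists_eq_add_one.2 hA0.card_pos
  have hΛ : Fintype.card (FermionTorus 2 L) = 2 * (k + 1) := by rw [← hk]; omega
  have h0 := groundEnergyAt_le_minEnergyOn_szSector_one (fermionTorusGraph 2 L) t U hΛ
  rw [card_fermionTorus_two'] at h0
  have h1 := hubbardTorus_szOne_add_ground_sub_U_le (L := L) hL t hU
  linarith

end Torus

end Literature.MathematicalPhysics.QuantumLattice
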